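import Summits.ResolutionOfSingularities.ResolutionOfSingularities.Theorems.HilbertSamuelEliminationSigmaMaxModificationsCorridor3FCR1
import Literature.AlgebraicGeometry.Resolution.FibreComponentsBaseChange
import HarnessLib

/-!
# Route `HilbertSamuelElimination`, crux `SigmaMaxModificationsCorridor3`
# (stmt-ResolutionOfSingularities-19249; child of `SigmaMaxModifications` stmt-…-18506),
# line `tame_wild` v3 — FC-R1 in the closure-dimension phrasing of the plan of record

[OURS · L1 W4.2] The rung FC-R1 (`fcR1`, p486665) restated with the conclusion of the planner's
typed signature (`L/w42/helpers-v2.lean` §FC, `stub_FC_R1_surface_components_generic`): every point of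
the surviving `ν`-stratum maps to a point of `Y` whose closure has dimension `≤ 1`, and the centres
are permissible. The translation: a point `η` of a scheme with `dim Y ≤ 3` and `dim 𝒪_{Y,η} ≥ 2` has
`dim cl{η} ≤ 1` (`dim cl{η} = height η`, `dim 𝒪_{Y,η} = coheight η`, `height + coheight ≤ dim Y`
in the specialisation order). Conditional on the same two printed facts (`hCJS`, `hK`).

NOT a statement of any manuscript; AI-written, weaker than expert review.

## Sources

* V. Cossart, U. Jannsen, S. Saito, LNM 2270 (2020), Thm. 1.2, Rem. 6.29 (1). [CossartJannsenSaito2020]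
* J. Kollár, *Lectures on Resolution of Singularities* (2007), Thm. 1.101. [Kollar2007]
* The Stacks Project, Tag 02IZ (`dim 𝒪_{X,x}` = codimension). [StacksProject]
-/

set_option linter.dupNamespace false -- mandated namespace of this single-conjunct summit

noncomputable section

open CategoryTheory AlgebraicGeometry TopologicalSpace Topology IsLocalRing Order
open Literature.AlgebraicGeometry.Resolution Literature.RingTheory.HilbertSamuel

namespace Summit.ResolutionOfSingularities.ResolutionOfSingularities.Theorems.SigmaMaxModificationsCorridor3.Helpers

universe u

/-- **`dim cl{η} + dim 𝒪_{Y,η} ≤ dim Y`, numerically: a point with `dim 𝒪_{Y,η} ≥ 2` on a scheme of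
dimension `≤ 3` has closure of dimension `≤ 1`.** (`dim cl{η} = height η`,
`dim 𝒪_{Y,η} = coheight η` (Stacks 02IZ), `height + coheight ≤ dim`.) [cite: StacksProject, Tag 02IZ] -/
theorem topologicalKrullDim_closure_le_one {Y : Scheme.{u}}
    (hdim : topologicalKrullDim Y ≤ ((3 : ℕ) : WithBot ℕ∞)) {η : Y}
    (hη : ((2 : ℕ) : WithBot ℕ∞) ≤ ringKrullDim (Y.presheaf.stalk η)) :
    topologicalKrullDim (closure ({η} : Set Y)) ≤ ((1 : ℕ) : WithBot ℕ∞) := by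
  rw [topologicalKrullDim_closure_singleton_eq_height]
  rw [ringKrullDim_stalk_eq_coheight] at hη
  have hYdim : topologicalKrullDim Y = krullDim Y :=
    Order.krullDim_eq_of_orderIso (irreducibleSetEquivPoints (α := Y))
  haveI : Nonempty Y := ⟨η⟩
  have hsum : ((height η + coheight η : ℕ∞) : WithBot ℕ∞) ≤ krullDim Y := by
    rw [Order.krullDim_eq_iSup_height_add_coheight_of_nonempty, WithBot.coe_le_coe]
    exact le_iSup (fun a : Y => height a + coheight a) η
  rw [← hYdim] at hsum
  have h3 : height η + coheight η ≤ ((3 : ℕ) : ℕ∞) := by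
    have := hsum.trans hdim
    rw [← WithBot.coe_natCast] at this
    exact WithBot.coe_le_coe.mp this
  have h2 : ((2 : ℕ) : ℕ∞) ≤ coheight η := by
    rw [← WithBot.coe_natCast] at hη
    exact WithBot.coe_le_coe.mp hη
  -- `height η ≤ 1`
  have hfin : height η ≠ ⊤ := by
    intro htop
    rw [htop, top_add] at h3
    exact absurd h3 (by simp)
  obtain ⟨n, hn⟩ := ENat.ne_top_iff_exists.mp hfin
  rw [← hn] at h3 ⊢
  have hcofin : coheight η ≠ ⊤ := by
    intro htop
    rw [htop, add_top] at h3
    exact absurd h3 (by simp)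
  obtain ⟨c, hc⟩ := ENat.ne_top_iff_exists.mp hcofin
  rw [← hc] at h3 h2
  have h3' : n + c ≤ 3 := by exact_mod_cast h3
  have h2' : 2 ≤ c := by exact_mod_cast h2
  have : n ≤ 1 := by omega
  exact_mod_cast this

/-- **FC-R1 in the phrasing of the plan of record** (CHAIN w42 §4 row stub-3; helpers-v2 §FC): for
`Y` reduced, locally of finite type and quasi-compact over a field, `dim Y ≤ 3`, `ν ∈ Σ_Y(3)^max`,
`ν ≠ Φ^{(3)}` — modulo CJS Thm. 1.2 with permissible centres (`hCJS`) and Krull 1930 / Kollár 2007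
Thm. 1.101 (`hK`) — there is a blow-up sequence with PERMISSIBLE (indeed regular) centres inside the
successive `ν`-strata after which every point of the `ν`-stratum maps to a point of `Y` whose closure
has dimension `≤ 1` (a curve point or a closed point): the 2-dimensional components of `Y(ν)` are
killed at their generic points. [cite: CossartJannsenSaito2020, Thm. 1.2, Rem. 6.29 (1)]
[cite: Kollar2007, Thm. 1.101] -/
theorem fcR1_closure (hCJS : CossartJannsenSaito2020SequencePermissible.{u})
    (hK : Kollar2007_thm_1_101_localChain.{u}) {k : Type u} [Field k] {Y : Scheme.{u}}
    (g : Y ⟶ Spec (.of k)) [LocallyOfFiniteType g] [QuasiCompact g] [IsReduced Y]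
    (hdim : topologicalKrullDim Y ≤ ((3 : ℕ) : WithBot ℕ∞)) {ν : ℕ → ℕ} (hν : ν ≠ iterPSum 3 Phi)
    (hmax : Maximal (· ∈ Scheme.hsValues Y 3) ν) :
    ∃ s : CentreSeq Y, s.AllPermissible ∧ s.AllRegular ∧ s.CentresInStratum 3 ν ∧
      ∀ y' : s.top, y' ∈ Scheme.hsStratum s.top 3 ν →
        topologicalKrullDim (closure ({s.comp.base y'} : Set Y)) ≤ ((1 : ℕ) : WithBot ℕ∞) := by
  haveI : IsLocallyNoetherian Y := LocallyOfFiniteType.isLocallyNoetherian g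
  have hexc : Scheme.IsExcellent Y :=
    Scheme.isExcellent_of_locallyOfFiniteType Stacks07QW_field_holds g
  obtain ⟨s, hreg, hstr, hpts⟩ := fcR1 hCJS hK g hdim hν hmax
  have hmono : ∀ y : s.top, Scheme.hsFun s.top 3 y ≤ Scheme.hsFun Y 3 (s.comp.base y) :=
    CentreSeq.hsFun_comp_le_of_allRegular_of_centresInStratum s hexc hdim hν hreg hstr
  refine ⟨s, CentreSeq.allPermissible_of_allRegular_of_centresInStratum s hexc hdim hν hreg hstr,
    hreg, hstr, fun y' hy' => topologicalKrullDim_closure_le_one hdim ?_⟩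
  -- `dim 𝒪_{Y,η} ≥ 2` at `η = s.comp y'`: it is `≠ 1` (fcR1) and `≠ 0` (`η ∈ Y(ν)` is not a
  -- maximal point of the reduced `Y`)
  have h1 : ringKrullDim (Y.presheaf.stalk (s.comp.base y')) ≠ 1 := hpts y' hy'
  have hην : s.comp.base y' ∈ Scheme.hsStratum Y 3 ν := by
    rw [Scheme.mem_hsStratum_iff]
    have h := (Scheme.mem_hsStratum_iff.mp hy') ▸ hmono y'
    exact le_antisymm (hmax.2 ⟨_, rfl⟩ h) h
  have h0 : ringKrullDim (Y.presheaf.stalk (s.comp.base y')) ≠ 0 := by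
    intro h0
    apply maximalIdeal_not_mem_minimalPrimes_of_mem_hsStratum hν hην
    haveI : (maximalIdeal (Y.presheaf.stalk (s.comp.base y'))).IsPrime := inferInstance
    rw [← Ideal.height_eq_zero_iff]
    have hh := IsLocalRing.maximalIdeal_height_eq_ringKrullDim (R := Y.presheaf.stalk (s.comp.base y'))
    rw [h0] at hh
    exact_mod_cast hh
  obtain ⟨d, hd⟩ : ∃ d : ℕ, ringKrullDim (Y.presheaf.stalk (s.comp.base y')) = d :=
    exists_nat_eq_of_ne_bot_of_ne_top ringKrullDim_ne_bot ringKrullDim_ne_top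
  rw [hd] at h1 h0 ⊢
  have hd1 : (d : WithBot ℕ∞) ≠ ((1 : ℕ) : WithBot ℕ∞) := by exact_mod_cast h1
  have hd0 : (d : WithBot ℕ∞) ≠ ((0 : ℕ) : WithBot ℕ∞) := by exact_mod_cast h0
  have : 2 ≤ d := by
    have h1' : d ≠ 1 := fun h => hd1 (by rw [h])
    have h0' : d ≠ 0 := fun h => hd0 (by rw [h])
    omega
  exact_mod_cast this

end Summit.ResolutionOfSingularities.ResolutionOfSingularities.Theorems.SigmaMaxModificationsCorridor3.Helpers

end
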